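import Summits.Ventures.CertifiedManyBodySolver.HubbardAlg.SdaDualEdgeEngine
import Summits.Ventures.CertifiedManyBodySolver.Rows.AndersonClusterSymmetries
import Literature.MathematicalPhysics.QuantumLattice.HubbardSectorEnclosureCertificate
import Literature.MathematicalPhysics.QuantumLattice.SectorVariationalBounds
import Literature.MathematicalPhysics.QuantumLattice.FermionEmbedLocality
import Literature.MathematicalPhysics.QuantumLattice.HubbardFermionInteractionTerms
import Literature.MathematicalPhysics.QuantumLattice.HubbardSpinFlipSymmetry
import HarnessLib

/-!
# SDA dual certificates, part 5 — the CLAIM NODE reduced to `(N↑, N↓)` sector blocks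

HONEST FRAMING: first certified bounds; not a superconductivity verdict; every number certified-of-record or labelled
FLOAT.  SOUNDNESS statements only; no number is certified in this module.

Parts 1–4 (`SdaDualEdge`, `SdaDualEdgeTW`, `SdaDualEdgeEngine`, `SdaDualEdgeSym`) turn an SDA dual certificate into a tree
node by name, leaving exactly ONE finite claim: the positive semidefiniteness of the `4^{|W|}`-dimensional window operator
`K = Γ(h_R) − E − c·1` (`ltiRectGSNodeTW_of_dualCert`, `ltiRectSymGSNodeTW_of_dualCert`, …).  The SDA engine and every
kit verifier check that claim SECTOR BY SECTOR (`sda-cert/1`: one `LDLᵀ` per `(N, S^z)` block; `3 × 3` window: 100 blocks of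
dimension `≤ 15 876` instead of one of dimension `262 144`).  This module proves, by name, that the per-sector check suffices:

* `preservesSectors_iff_commute`: an operator on the Fock space over any finite site type conserves `(N↑, N↓)`
  (`PreservesSectors`, the tree's Lieb-1989 predicate) iff it commutes with `N_↑ = Σ_x n_{x↑}` and `N_↓ = Σ_x n_{x↓}`
  (`sum_numberOp_eq_diagonal`: `N_σ` is the diagonal matrix of the sector label).
* `commute_fermionEmbed_sum_numberOp` (graded locality, `FermionEmbedLocality`): the structure maps `Γ(φ)` of the local
  algebras carry `N_σ`-commuting observables to `N_σ`-commuting observables, hence `preservesSectors_fermionEmbed`: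
  **`Γ(φ)` preserves sector conservation** — so every SDA generator built from sector-conserving words (transfers
  `Γ(ι)A − Γ(τ)A`, relocated stability / EOM pieces `twOp`, `commOp`, `stabOp` of parts 2–3, the spin-flip row
  `relabel spinSwap A − A`, the `SU(2)` row `S⁺A − AS⁺` for a spin-LOWERING word `A`) and the embedded cluster Hamiltonian
  `Γ(h_R)` (`preservesSectors_clusterHamiltonian`) conserve `(N↑, N↓)` on the window.
* `posSemidef_of_sectorBlocks` / `posSemidef_iff_sectorBlocks`: a sector-conserving `K` is positive semidefinite iff its
  `(a, b)`-sector blocks `K.toBlock (sectorPred a b) (sectorPred a b)` (`a, b ≤` number of sites) are — the quadratic form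
  splits along the sector projections (`dotProduct_mulVec_eq_sum_sectors`), each piece being a block quadratic form
  (`SectorVariationalBounds.star_restrict_dotProduct_toBlock_mulVec`).
* `claim_posSemidef_of_sectorBlocks`: THE SDA CLAIM NODE from its sector blocks — for a sector-conserving certificate
  operator `E`, `PosSemidef (Γ(h_R) − E − c·1)` follows from the `(|W| + 1)²` block claims, each of which is what a kit
  verifier (or `native_decide` on small windows) actually certifies.

References: E. H. Lieb, PRL **62** (1989) 1201, Remark (2) (conservation of `N↑, N↓`; sectors) [cite: LiebPRL1989,
Remark (2)]; H. Tasaki, *Physics and Mathematics of Quantum Many-Body Systems* (2020) §9.3 [cite: Tasaki2020, §9.3];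
O. Bratteli, D. W. Robinson, *Operator Algebras and Quantum Statistical Mechanics 2* (1997) §5.2.2 (graded locality)
[cite: BratteliRobinsonII1997, §5.2.2]; Horn–Johnson, *Matrix Analysis* (2013) Obs. 7.1.2 (block-diagonal PSD) [folklore].
-/

noncomputable section

open Matrix Complex Finset
open scoped ComplexOrder MatrixOrder BigOperators
open Literature.Probability.LatticeModels
open Literature.MathematicalPhysics.QuantumLattice
open Literature.MathematicalPhysics.QuantumLattice.AndersonCluster
open Literature.MathematicalPhysics.QuantumLattice.HubbardWave0
open Literature.MathematicalPhysics.QuantumLattice.ThermodynamicLimit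
open Summit.Ventures.CertifiedManyBodySolver.Rows.RectMarginalNodes

namespace Summit.Ventures.CertifiedManyBodySolver.HubbardAlg.SdaDualEdge

/-! ### Sector conservation: closure lemmas and the commutation criterion -/

section Generic

variable {Λ : Type*} [LinearOrder Λ] [Fintype Λ]

/-- Differences of sector-conserving operators conserve sectors (restates `…HubbardSuperconductivity.Theorems.preservesSectors_sub`
of another summit tree, not importable here). [cite: LiebPRL1989, Remark (2)] -/
theorem preservesSectors_sub {M N : Matrix (Finset (Orb Λ)) (Finset (Orb Λ)) ℂ} (hM : PreservesSectors M)
    (hN : PreservesSectors N) : PreservesSectors (M - N) := by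
  intro s s' h
  rw [Matrix.sub_apply] at h
  by_cases hm : M s s' = 0
  · rw [hm, zero_sub, neg_ne_zero] at h
    exact hN s s' h
  · exact hM s s' hm

/-- Adjoints of sector-conserving operators conserve sectors. [cite: LiebPRL1989, Remark (2)] -/
theorem preservesSectors_conjTranspose {M : Matrix (Finset (Orb Λ)) (Finset (Orb Λ)) ℂ} (hM : PreservesSectors M) :
    PreservesSectors Mᴴ := by
  intro s s' h
  rw [conjTranspose_apply, star_ne_zero] at h
  exact ⟨(hM s' s h).1.symm, (hM s' s h).2.symm⟩

/-- The identity conserves sectors. [folklore] -/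
theorem preservesSectors_one : PreservesSectors (1 : Matrix (Finset (Orb Λ)) (Finset (Orb Λ)) ℂ) := by
  rw [← diagonal_one]; exact PreservesSectors.diagonal _

/-- A spin-raising operator times a spin-lowering one conserves sectors (`S⁺ A`, `A` lowering; restates the other summit
tree's non-importable `Summit.HubbardSuperconductivity.NoGo.preservesSectors_raises_mul_lowers`). [cite: Tasaki2020, §9.3] -/
theorem preservesSectors_mul_of_raises_of_lowers {M N : Matrix (Finset (Orb Λ)) (Finset (Orb Λ)) ℂ}
    (hM : RaisesSpin M) (hN : LowersSpin N) : PreservesSectors (M * N) := by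
  intro s s'' h
  rw [Matrix.mul_apply] at h
  obtain ⟨s', -, hs'⟩ := Finset.exists_ne_zero_of_sum_ne_zero h
  have h1 := hM s s' (left_ne_zero_of_mul hs')
  have h2 := hN s' s'' (right_ne_zero_of_mul hs')
  omega

/-- A spin-lowering operator times a spin-raising one conserves sectors (`A S⁺`, `A` lowering). [cite: Tasaki2020, §9.3] -/
theorem preservesSectors_mul_of_lowers_of_raises {M N : Matrix (Finset (Orb Λ)) (Finset (Orb Λ)) ℂ}
    (hM : LowersSpin M) (hN : RaisesSpin N) : PreservesSectors (M * N) := by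
  intro s s'' h
  rw [Matrix.mul_apply] at h
  obtain ⟨s', -, hs'⟩ := Finset.exists_ne_zero_of_sum_ne_zero h
  have h1 := hM s s' (left_ne_zero_of_mul hs')
  have h2 := hN s' s'' (right_ne_zero_of_mul hs')
  omega

/-- **The `SU(2)` row word conserves sectors**: `S⁺ A − A S⁺` conserves `(N↑, N↓)` for a spin-lowering word `A` (the only
`SU(2)` rows an `(N, S^z)`-blocked certificate uses). [cite: Tasaki2020, §9.3] -/
theorem preservesSectors_spinPlus_comm {A : Matrix (Finset (Orb Λ)) (Finset (Orb Λ)) ℂ} (hA : LowersSpin A) :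
    PreservesSectors (spinPlus * A - A * spinPlus) :=
  preservesSectors_sub (preservesSectors_mul_of_raises_of_lowers LiebThm1.raisesSpin_spinPlus hA)
    (preservesSectors_mul_of_lowers_of_raises hA LiebThm1.raisesSpin_spinPlus)

/-- `N_σ = Σ_x n_{xσ}` is the diagonal matrix of the `σ`-count of a configuration. [cite: LiebPRL1989, proof of Theorem 1] -/
theorem sum_numberOp_eq_diagonal (σ : Fin 2) : (∑ x : Λ, (numberOp x σ : Matrix (Finset (Orb Λ)) (Finset (Orb Λ)) ℂ)) =
    diagonal fun s => (((Finset.univ.filter fun x : Λ => orb x σ ∈ s).card : ℕ) : ℂ) := by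
  ext s s'
  rw [Matrix.sum_apply]
  simp only [LiebThm1.numberOp_eq_diagonal, diagonal_apply]
  by_cases h : s = s'
  · subst h
    simp only [if_true]
    rw [Finset.sum_boole]
  · simp only [h, if_false, Finset.sum_const_zero]

/-- A sector-conserving operator commutes with each `N_σ`. [cite: LiebPRL1989, Remark (2)] -/
theorem commute_sum_numberOp_of_preservesSectors {M : Matrix (Finset (Orb Λ)) (Finset (Orb Λ)) ℂ}
    (hM : PreservesSectors M) (σ : Fin 2) :
    Commute M (∑ x : Λ, (numberOp x σ : Matrix (Finset (Orb Λ)) (Finset (Orb Λ)) ℂ)) := by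
  rw [sum_numberOp_eq_diagonal]
  match σ with
  | 0 => exact hM.commute_diagonal fun a _ => (a : ℂ)
  | 1 => exact hM.commute_diagonal fun _ b => (b : ℂ)

/-- **Commutation criterion**: an operator commuting with `N_↑` and `N_↓` conserves `(N↑, N↓)` (an off-sector entry
`K s s' ≠ 0` would force `#σ(s) = #σ(s')`). [cite: Tasaki2020, §9.3] -/
theorem preservesSectors_of_commute {M : Matrix (Finset (Orb Λ)) (Finset (Orb Λ)) ℂ}
    (h0 : Commute M (∑ x : Λ, (numberOp x 0 : Matrix (Finset (Orb Λ)) (Finset (Orb Λ)) ℂ)))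
    (h1 : Commute M (∑ x : Λ, (numberOp x 1 : Matrix (Finset (Orb Λ)) (Finset (Orb Λ)) ℂ))) : PreservesSectors M := by
  rw [sum_numberOp_eq_diagonal] at h0 h1
  have key : ∀ {f : Finset (Orb Λ) → ℕ}, Commute M (diagonal fun s => (f s : ℂ)) →
      ∀ s s', M s s' ≠ 0 → f s = f s' := by
    intro f hc s s' hne
    have h := congr_fun (congr_fun hc.eq s) s'
    rw [mul_diagonal, diagonal_mul] at h
    have h2 : ((f s : ℂ) - f s') * M s s' = 0 := by
      rw [sub_mul, ← h]
      ring
    rcases mul_eq_zero.1 h2 with h3 | h3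
    · exact_mod_cast sub_eq_zero.1 h3
    · exact absurd h3 hne
  intro s s' hne
  exact ⟨key h0 s s' hne, key h1 s s' hne⟩

/-- **`PreservesSectors K ↔ [K, N_↑] = [K, N_↓] = 0`.** [cite: Tasaki2020, §9.3] -/
theorem preservesSectors_iff_commute {M : Matrix (Finset (Orb Λ)) (Finset (Orb Λ)) ℂ} :
    PreservesSectors M ↔
      Commute M (∑ x : Λ, (numberOp x 0 : Matrix (Finset (Orb Λ)) (Finset (Orb Λ)) ℂ)) ∧
        Commute M (∑ x : Λ, (numberOp x 1 : Matrix (Finset (Orb Λ)) (Finset (Orb Λ)) ℂ)) :=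
  ⟨fun h => ⟨commute_sum_numberOp_of_preservesSectors h 0, commute_sum_numberOp_of_preservesSectors h 1⟩,
    fun h => preservesSectors_of_commute h.1 h.2⟩

/-- The spin-flipped operator `relabel spinSwap A` of a sector-conserving `A` conserves sectors (it commutes with
`N_{1-σ}`), hence so does the spin-flip row word `relabel spinSwap A − A`. [cite: Tasaki2020, §9.3] -/
theorem preservesSectors_relabel_spinSwap {A : Matrix (Finset (Orb Λ)) (Finset (Orb Λ)) ℂ} (hA : PreservesSectors A) :
    PreservesSectors (relabel (Orb.spinSwap : Orb Λ ≃ Orb Λ) A) := by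
  have key : ∀ σ : Fin 2, Commute (relabel (Orb.spinSwap : Orb Λ ≃ Orb Λ) A)
      (∑ x : Λ, (numberOp x (Equiv.swap (0 : Fin 2) 1 σ) : Matrix (Finset (Orb Λ)) (Finset (Orb Λ)) ℂ)) := by
    intro σ
    have h := (commute_sum_numberOp_of_preservesSectors hA σ).map (relabel (Orb.spinSwap : Orb Λ ≃ Orb Λ))
    rw [map_sum] at h
    simpa only [relabel_spinSwap_numberOp] using h
  refine preservesSectors_of_commute ?_ ?_
  · simpa using key 1
  · simpa using key 0

end Generic

/-! ### `Γ(φ)` preserves sector conservation (graded locality) -/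

section Embed

variable {Λ Λ' : Type*} [LinearOrder Λ] [Fintype Λ] [LinearOrder Λ'] [Fintype Λ']

/-- The orbitals over a site set and over its complement are disjoint. [folklore] -/
theorem disjoint_orbs_compl (S : Finset Λ') : Disjoint (orbs Sᶜ) (orbs S) := by
  rw [Finset.disjoint_left]
  intro i h1 h2
  rw [mem_orbs] at h1 h2
  exact (Finset.mem_compl.1 h1) h2

/-- **`Γ(φ)` carries `N_σ`-commuting observables to `N_σ`-commuting observables**: the image part of `N_σ(Λ')` is
`Γ(φ)(N_σ(Λ))`, the rest is even and supported away from the image, so it commutes with `Γ(φ) A` by graded locality.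
[cite: BratteliRobinsonII1997, §5.2.2] -/
theorem commute_fermionEmbed_sum_numberOp (φ : Λ ↪ Λ') (σ : Fin 2) {A : Matrix (Finset (Orb Λ)) (Finset (Orb Λ)) ℂ}
    (hA : Commute A (∑ x : Λ, (numberOp x σ : Matrix (Finset (Orb Λ)) (Finset (Orb Λ)) ℂ))) :
    Commute (fermionEmbed φ A) (∑ x' : Λ', (numberOp x' σ : Matrix (Finset (Orb Λ')) (Finset (Orb Λ')) ℂ)) := by
  have himage : ∑ x' ∈ (Finset.univ : Finset Λ).map φ, (numberOp x' σ : Matrix (Finset (Orb Λ')) (Finset (Orb Λ')) ℂ) =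
      fermionEmbed φ (∑ x : Λ, (numberOp x σ : Matrix (Finset (Orb Λ)) (Finset (Orb Λ)) ℂ)) := by
    rw [Finset.sum_map, fermionEmbed_sum]
    exact Finset.sum_congr rfl fun x _ => (fermionEmbed_numberOp φ x σ).symm
  have hfar : ∑ x' ∈ ((Finset.univ : Finset Λ).map φ)ᶜ, (numberOp x' σ : Matrix (Finset (Orb Λ')) (Finset (Orb Λ')) ℂ) ∈
      carEvenSubalgebra (orbs ((Finset.univ : Finset Λ).map φ)ᶜ) :=
    Subalgebra.sum_mem _ fun x' hx' => numberOp_mem_carEvenSubalgebra (orb_mem_orbs.2 hx')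
  rw [← Finset.sum_add_sum_compl ((Finset.univ : Finset Λ).map φ), himage]
  refine Commute.add_right ?_ ?_
  · rw [Commute, SemiconjBy, ← fermionEmbed_mul, hA.eq, fermionEmbed_mul]
  · exact (commute_fermionEmbed_of_mem_carEvenSubalgebra φ A hfar (disjoint_orbs_compl _)).symm

/-- **`Γ(φ)` preserves sector conservation**: the embedding of a `(N↑, N↓)`-conserving local observable conserves
`(N↑, N↓)` of the larger region. [cite: LiebPRL1989, Remark (2)] -/
theorem preservesSectors_fermionEmbed (φ : Λ ↪ Λ') {A : Matrix (Finset (Orb Λ)) (Finset (Orb Λ)) ℂ}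
    (hA : PreservesSectors A) : PreservesSectors (fermionEmbed φ A) :=
  preservesSectors_of_commute
    (commute_fermionEmbed_sum_numberOp φ 0 (commute_sum_numberOp_of_preservesSectors hA 0))
    (commute_fermionEmbed_sum_numberOp φ 1 (commute_sum_numberOp_of_preservesSectors hA 1))

/-- Transfer words `Γ(φ) A − Γ(ψ) A` (TI transfers `Γ(ι)A − Γ(τ_v)A`, point-group transfers `Γ(ι)A − Γ(g)A`) of a
sector-conserving `A` conserve sectors. [cite: LiebPRL1989, Remark (2)] -/
theorem preservesSectors_fermionEmbed_sub (φ ψ : Λ ↪ Λ') {A : Matrix (Finset (Orb Λ)) (Finset (Orb Λ)) ℂ}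
    (hA : PreservesSectors A) : PreservesSectors (fermionEmbed φ A - fermionEmbed ψ A) :=
  preservesSectors_sub (preservesSectors_fermionEmbed φ hA) (preservesSectors_fermionEmbed ψ hA)

end Embed

/-! ### Positive semidefiniteness from the sector blocks -/

section Blocks

variable {Λ : Type*} [LinearOrder Λ] [Fintype Λ]

/-- Moving a sector projection across the pairing: `⟨x, P y⟩ = ⟨P x, y⟩`. [folklore] -/
theorem star_dotProduct_sectorProj (a b : ℕ) (x y : Finset (Orb Λ) → ℂ) :
    star x ⬝ᵥ sectorProj a b y = star (sectorProj a b x) ⬝ᵥ y := by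
  simp only [dotProduct, Pi.star_apply, sectorProj_apply]
  refine Finset.sum_congr rfl fun s _ => ?_
  split_ifs <;> simp

/-- Sector projections are idempotent. [folklore] -/
theorem sectorProj_sectorProj (a b : ℕ) (x : Finset (Orb Λ) → ℂ) : sectorProj a b (sectorProj a b x) = sectorProj a b x := by
  funext s
  simp only [sectorProj_apply]
  split_ifs <;> rfl

/-- Every vector is the sum of its sector projections over the `(|Λ| + 1)²` sector labels. [folklore] -/
theorem sum_range_sectorProj_eq_self (x : Finset (Orb Λ) → ℂ) :
    ∑ c ∈ range (Fintype.card Λ + 1) ×ˢ range (Fintype.card Λ + 1), sectorProj c.1 c.2 x = x := by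
  funext s
  rw [Finset.sum_apply]
  simp only [sectorProj_apply]
  rw [Finset.sum_eq_single ((upPart s).card, (downPart s).card)]
  · exact if_pos ⟨rfl, rfl⟩
  · rintro c - hc
    exact if_neg fun h => hc (Prod.ext h.1.symm h.2.symm)
  · intro h
    exact absurd (Finset.mem_product.2 ⟨Finset.mem_range.2 (Nat.lt_succ_of_le (Finset.card_le_univ _)),
      Finset.mem_range.2 (Nat.lt_succ_of_le (Finset.card_le_univ _))⟩) h

/-- **The quadratic form of a sector-conserving operator splits along the sectors**:
`⟨x, K x⟩ = Σ_{(a,b)} ⟨P_{ab} x, K P_{ab} x⟩`. [cite: LiebPRL1989, Remark (2)] -/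
theorem dotProduct_mulVec_eq_sum_sectors {K : Matrix (Finset (Orb Λ)) (Finset (Orb Λ)) ℂ} (hK : PreservesSectors K)
    (x : Finset (Orb Λ) → ℂ) :
    star x ⬝ᵥ (K *ᵥ x) = ∑ c ∈ range (Fintype.card Λ + 1) ×ˢ range (Fintype.card Λ + 1),
      star (sectorProj c.1 c.2 x) ⬝ᵥ (K *ᵥ sectorProj c.1 c.2 x) := by
  have h1 : K *ᵥ x = ∑ c ∈ range (Fintype.card Λ + 1) ×ˢ range (Fintype.card Λ + 1), K *ᵥ sectorProj c.1 c.2 x := by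
    conv_lhs => rw [← sum_range_sectorProj_eq_self x]
    rw [Matrix.mulVec_sum]
  rw [h1, dotProduct_sum]
  refine Finset.sum_congr rfl fun c _ => ?_
  rw [hK.mulVec_sectorProj, star_dotProduct_sectorProj c.1 c.2 x (K *ᵥ x),
    star_dotProduct_sectorProj c.1 c.2 (sectorProj c.1 c.2 x) (K *ᵥ x), sectorProj_sectorProj]

/-- A sector-conserving operator whose sector blocks are Hermitian is Hermitian. [folklore] -/
theorem isHermitian_of_sectorBlocks {K : Matrix (Finset (Orb Λ)) (Finset (Orb Λ)) ℂ} (hK : PreservesSectors K)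
    (h : ∀ a b : ℕ, a ≤ Fintype.card Λ → b ≤ Fintype.card Λ →
      (K.toBlock (Hubbard.sectorPred a b) (Hubbard.sectorPred a b)).IsHermitian) : K.IsHermitian := by
  refine Matrix.IsHermitian.ext fun s s' => ?_
  by_cases hc : (upPart s).card = (upPart s').card ∧ (downPart s).card = (downPart s').card
  · have hb := h (upPart s).card (downPart s).card (Finset.card_le_univ _) (Finset.card_le_univ _)
    exact hb.apply ⟨s, (⟨rfl, rfl⟩ : Hubbard.sectorPred _ _ s)⟩ ⟨s', (⟨hc.1.symm, hc.2.symm⟩ : Hubbard.sectorPred _ _ s')⟩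
  · have h1 : K s s' = 0 := not_not.1 (mt (hK s s') hc)
    have h2 : K s' s = 0 := not_not.1 (mt (hK s' s) fun h' => hc ⟨h'.1.symm, h'.2.symm⟩)
    rw [h1, h2, star_zero]

/-- **PSD from the sector blocks**: a `(N↑, N↓)`-conserving operator all of whose `(a, b)`-sector blocks (`a, b ≤ |Λ|`)
are positive semidefinite is positive semidefinite. [cite: LiebPRL1989, Remark (2)] -/
theorem posSemidef_of_sectorBlocks {K : Matrix (Finset (Orb Λ)) (Finset (Orb Λ)) ℂ} (hK : PreservesSectors K)
    (h : ∀ a b : ℕ, a ≤ Fintype.card Λ → b ≤ Fintype.card Λ →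
      (K.toBlock (Hubbard.sectorPred a b) (Hubbard.sectorPred a b)).PosSemidef) : K.PosSemidef := by
  refine PosSemidef.of_dotProduct_mulVec_nonneg (isHermitian_of_sectorBlocks hK fun a b ha hb => (h a b ha hb).1)
    fun x => ?_
  rw [dotProduct_mulVec_eq_sum_sectors hK x]
  refine Finset.sum_nonneg fun c hc => ?_
  obtain ⟨ha, hb⟩ := Finset.mem_product.1 hc
  rw [← star_restrict_dotProduct_toBlock_mulVec (Hubbard.sectorPred c.1 c.2) K (sectorProj c.1 c.2 x)
    (fun s hs => if_neg (show ¬((upPart s).card = c.1 ∧ (downPart s).card = c.2) from hs))]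
  exact (h c.1 c.2 (Nat.le_of_lt_succ (Finset.mem_range.1 ha)) (Nat.le_of_lt_succ (Finset.mem_range.1 hb))).dotProduct_mulVec_nonneg _

/-- **`K ⪰ 0 ↔` every sector block `⪰ 0`** for a `(N↑, N↓)`-conserving `K`. [cite: LiebPRL1989, Remark (2)] -/
theorem posSemidef_iff_sectorBlocks {K : Matrix (Finset (Orb Λ)) (Finset (Orb Λ)) ℂ} (hK : PreservesSectors K) :
    K.PosSemidef ↔ ∀ a b : ℕ, (K.toBlock (Hubbard.sectorPred a b) (Hubbard.sectorPred a b)).PosSemidef :=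
  ⟨fun h _ _ => h.submatrix _, fun h => posSemidef_of_sectorBlocks hK fun a b _ _ => h a b⟩

end Blocks

/-! ### The Hubbard terms, the cluster Hamiltonian and the SDA operators conserve `(N↑, N↓)` -/

section Lattice

variable {d : ℕ}

/-- Every term `Φ X` of the Hubbard interaction conserves `(N↑, N↓)` (on-site `U n↑n↓`, bond hopping, or `0`).
[cite: LiebPRL1989, Remark (2)] -/
theorem preservesSectors_hubbardΦ (t U : ℝ) (X : Finset (Site d)) :
    PreservesSectors ((hubbardFermionInteraction d t U).Φ X) := by
  by_cases h1 : ∃ x : Site d, X = {x}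
  · obtain ⟨x, rfl⟩ := h1
    rw [hubbardFermionInteraction_apply_singleton]
    exact ((LiebThm1.preservesSectors_numberOp _ 0).mul (LiebThm1.preservesSectors_numberOp _ 1)).smul _
  by_cases h2 : ∃ (x : Site d) (i : Fin d), X = {x, x + unitVec i}
  · obtain ⟨x, i, rfl⟩ := h2
    rw [hubbardFermionInteraction_apply_pair]
    refine (PreservesSectors.sum fun σ _ => ?_).smul _
    exact (LiebThm1.preservesSectors_hopping _ _ σ).add (LiebThm1.preservesSectors_hopping _ _ σ)
  · rw [hubbardFermionInteraction_apply_eq_zero t U (fun x hx => h1 ⟨x, hx⟩) (fun x i hx => h2 ⟨x, i, hx⟩)]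
    exact PreservesSectors.zero

/-- **The weighted open-cluster Hubbard Hamiltonian `h_R(J, V, μ)` conserves `(N↑, N↓)`.** [cite: LiebPRL1989, Remark (2)] -/
theorem preservesSectors_clusterHamiltonian (R : Finset (Site d)) (t U : ℝ) (J : Site d → Fin d → ℝ) (V μ : Site d → ℝ) :
    PreservesSectors (clusterHamiltonian R t U J V μ) := by
  unfold clusterHamiltonian
  refine (((PreservesSectors.sum fun y _ => PreservesSectors.sum fun i _ =>
      (Summit.Ventures.CertifiedManyBodySolver.Rows.preservesSectors_clusterBondKinetic y i).smul _).smul _).add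
    ((PreservesSectors.sum fun y _ =>
      ((LiebThm1.preservesSectors_numberOp y 0).mul (LiebThm1.preservesSectors_numberOp y 1)).smul _).smul _)).add
    (PreservesSectors.sum fun y _ =>
      ((LiebThm1.preservesSectors_numberOp y 0).add (LiebThm1.preservesSectors_numberOp y 1)).smul _)

variable {t U : ℝ} {W Λ : Finset (Site 2)} {A : FermionOp Λ}

/-- The relocated operator `twOp D = Σ_k Γ(τ_{v_k} B_k)` of a datum with sector-conserving pieces conserves sectors. [folklore] -/
theorem preservesSectors_twOp (D : TWDatum t U W Λ A) (h : ∀ k, PreservesSectors (D.B k)) : PreservesSectors (twOp D) := by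
  unfold twOp; exact PreservesSectors.sum fun k _ => preservesSectors_fermionEmbed _ (h k)

/-- The relocated stability operator of a polar datum with sector-conserving pieces conserves sectors. [folklore] -/
theorem preservesSectors_stabOp (P : TWPolarDatum t U W Λ A) (h : ∀ k, PreservesSectors (P.B k)) :
    PreservesSectors P.stabOp := by
  unfold TWPolarDatum.stabOp
  exact PreservesSectors.sum fun k _ => preservesSectors_fermionEmbed _ (h k)

/-- The relocated EOM operator of a polar datum with sector-conserving pieces conserves sectors. [folklore] -/
theorem preservesSectors_commOp (P : TWPolarDatum t U W Λ A) (h : ∀ k, PreservesSectors (P.C k)) :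
    PreservesSectors P.commOp := by
  unfold TWPolarDatum.commOp
  exact PreservesSectors.sum fun k _ => preservesSectors_fermionEmbed _ (h k)

/-- The engine's commutator piece `termComm X = Γ(Φ X)Γ(A) − Γ(A)Γ(Φ X)` (`A` sector-conserving) conserves sectors. [folklore] -/
theorem preservesSectors_termComm (t U : ℝ) (hA : PreservesSectors A) (X : Finset (Site 2)) :
    PreservesSectors (termComm t U Λ A X) := by
  unfold termComm
  exact preservesSectors_sub
    ((preservesSectors_fermionEmbed _ (preservesSectors_hubbardΦ t U X)).mul (preservesSectors_fermionEmbed _ hA))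
    ((preservesSectors_fermionEmbed _ hA).mul (preservesSectors_fermionEmbed _ (preservesSectors_hubbardΦ t U X)))

/-- The engine's stability piece `termStab X = Γ(A)ᴴ · termComm X` (`A` sector-conserving) conserves sectors. [folklore] -/
theorem preservesSectors_termStab (t U : ℝ) (hA : PreservesSectors A) (X : Finset (Site 2)) :
    PreservesSectors (termStab t U Λ A X) := by
  unfold termStab
  exact (preservesSectors_conjTranspose (preservesSectors_fermionEmbed _ hA)).mul (preservesSectors_termComm t U hA X)

/-- **The Hubbard engine datum's relocated EOM operator conserves sectors** (`A` sector-conserving). [folklore] -/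
theorem preservesSectors_hubbardEngine_commOp (hA : PreservesSectors A) (v : Finset (Site 2) → Site 2)
    (hv : ∀ X ∈ hubbardTerms Λ, shiftSet (v X) (Λ ∪ X) ⊆ W) :
    PreservesSectors (hubbardEngineDatum t U Λ A v hv).commOp :=
  preservesSectors_commOp _ fun _ => preservesSectors_termComm t U hA _

/-- **The Hubbard engine datum's relocated stability operator conserves sectors** (`A` sector-conserving). [folklore] -/
theorem preservesSectors_hubbardEngine_stabOp (hA : PreservesSectors A) (v : Finset (Site 2) → Site 2)
    (hv : ∀ X ∈ hubbardTerms Λ, shiftSet (v X) (Λ ∪ X) ⊆ W) :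
    PreservesSectors (hubbardEngineDatum t U Λ A v hv).stabOp :=
  preservesSectors_stabOp _ fun _ => preservesSectors_termStab t U hA _

/-- **THE SDA CLAIM NODE FROM ITS SECTOR BLOCKS.**  For a `(N↑, N↓)`-conserving certificate operator `E ∈ 𝔄_W` (a sum of
the sector-conserving generator words above), the one finite claim `Γ(h_R) − E − c·1 ⪰ 0` of the dual-certificate edges
(`ltiRectGSNodeTW_of_dualCert`, `ltiRectSymGSNodeTW_of_dualCert`, …) follows from the positive semidefiniteness of its
`(|W| + 1)²` sector blocks — the per-sector `LDLᵀ` checks a verifier actually performs. [cite: LiebPRL1989, Remark (2)] -/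
theorem claim_posSemidef_of_sectorBlocks {R : Finset (Site 2)} (hR : R ⊆ W) (t U : ℝ) (J : Site 2 → Fin 2 → ℝ)
    (V μ : Site 2 → ℝ) {E : FermionOp W} (hE : PreservesSectors E) (c : ℝ)
    (h : ∀ a b : ℕ, a ≤ Fintype.card (PolySite W) → b ≤ Fintype.card (PolySite W) →
      ((fermionEmbed (PolySite.incl hR) (clusterHamiltonian R t U J V μ) - E - (c : ℂ) • 1).toBlock
        (Hubbard.sectorPred a b) (Hubbard.sectorPred a b)).PosSemidef) :
    (fermionEmbed (PolySite.incl hR) (clusterHamiltonian R t U J V μ) - E - (c : ℂ) • (1 : FermionOp W)).PosSemidef :=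
  posSemidef_of_sectorBlocks
    (preservesSectors_sub (preservesSectors_sub
      (preservesSectors_fermionEmbed _ (preservesSectors_clusterHamiltonian R t U J V μ)) hE) (preservesSectors_one.smul _)) h

end Lattice

end Summit.Ventures.CertifiedManyBodySolver.HubbardAlg.SdaDualEdge
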